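import Summits.ResolutionOfSingularities.ResolutionOfSingularities.Theorems.WeightedInvariantELadderTwoMaxClosed
import Summits.ResolutionOfSingularities.ResolutionOfSingularities.Theorems.WeightedInvariantELadderTwoGenericOffSupport
import HarnessLib

/-!
# Rung `e = 2`: the E2 CENTRE `stub_e2_centre_h` rests on the gluing piece (C-c) alone

Cell `res-hironaka`, line `L W4.3`, door crux `HypersurfaceCentreConstruction` (stmt-ResolutionOfSingularities-19897),
E2 tier; registrar res-L1-w43-plan-1, SPEC (Δ9) (`E2Step_split_sketch.lean` rev 7 fcdc0596e838faab, glue `stub_e2_centre_h_of_pieces`);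
E2 assembler res-D-pv-031 (DEALER 19:27:40Z (2b)).  OURS bookkeeping; nothing here is a statement of [Hironaka2017]; AI-written,
weaker than expert review.

Of the four centre pieces of SPEC (Δ9), three are tree theorems under the graded HOM rung `PRungGrHomLE 3 p ι J`:
(C-a) `LocalEngine.e2MaxNonempty` (…ELadderTwoMuAttained), (C-b) `LocalEngine.e2MaxClosed` (…ELadderTwoMaxClosed), (C-d)
`LocalEngine.e2GenericOffSupport` / `e2CentreH_of_forall_exists_admissible_canonical` (…ELadderTwoGenericOffSupport, res-L1-type-o6).
Hence:

* `E2CentreGlueBody p ι J` — the registrar's (C-c), Lean statement VERBATIM (spec `[folklore]` tag dropped: OURS interface `Prop`);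
* `stub_e2_centre_h_of_glue` — **`(∀ p, p.Prime → ∀ ι J, PRungGrHomLE 3 p ι J → E2CentreGlueBody p ι J) → ∀ p, p.Prime → ∀ ι J, E2CentreH p ι J`**,
  i.e. the registered `stub_e2_centre_h` BY ITS STATEMENT from the single hypothesis (C-c).
-/

noncomputable section

set_option linter.dupNamespace false -- mandated namespace of this single-conjunct summit

open CategoryTheory AlgebraicGeometry TopologicalSpace
open Literature.AlgebraicGeometry.Resolution
open Summit.ResolutionOfSingularities.ResolutionOfSingularities.Theorems
open Summit.ResolutionOfSingularities.ResolutionOfSingularities.Theorems.ELadderOne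

namespace Summit.ResolutionOfSingularities.ResolutionOfSingularities.Cruxes.HypersurfaceCentreConstruction.LocalEngine

/-- (C-c) **GLUING THE LOCAL CANONICAL CENTRES INTO AN ADMISSIBLE CANONICAL CENTRE** (size XL; the heart of (o47)): given (C-a) and (C-b) for
the stage, there is `R : ReesAlgebraData S.Y` with `IsCanonicalCentre₂ ι J R` (support = closure of the maximum locus, stalks `= J(𝒪_{Y,η}, f_η)` on
it, `= ⊤` off it) which is ADMISSIBLE.  Design note (registrar): define `R.piece n` by STALK PRESCRIPTION at the points of `maxLocus₂` (and `⊤` off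
the closure) and prove quasi-coherence LOCALLY from (open″)≤3 `JOpenPresentationForallSingLE` (the presented ideal has the prescribed stalks at every
read point of the neighbourhood) — no cocycle bookkeeping; local uniqueness = SPEC (Δ5) `HomogeneousLocalUnique` (PROVED); admissibility from the
presentation's regular parameters + (hom)/(c11) via SWEEP; inputs 060's (H3)/(K-red)/(K). [OURS · candidate · registrar SPEC (Δ9)] -/
def E2CentreGlueBody (p : ℕ) (ι : (R : Type) → [CommRing R] → R → Ordinal.{0})
    (J : (R : Type) → [CommRing R] → R → ℕ → Ideal R) : Prop :=
  ∀ ⦃k : Type⦄ [Field k] [CharP k p] [PerfectField k] (S : Stage k), S.InvDim₂ → ¬ Scheme.IsRegular S.X →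
    (S.maxLocus₂ ι).Nonempty → (∀ y ∈ S.genSing₂, y ∈ closure (S.maxLocus₂ ι) → y ∈ S.maxLocus₂ ι) →
    ∃ R : ReesAlgebraData S.Y, IsAdmissibleCentre S.f S.i.ker R ∧ S.IsCanonicalCentre₂ ι J R

/-- **The E2 centre under the graded HOM rung from (C-c) alone**: with (C-a) `e2MaxNonempty`, (C-b) `e2MaxClosed` and the
self-closing (C-d) slot (`e2CentreH_of_forall_exists_admissible_canonical`), `E2CentreH p ι J` follows from `E2CentreGlueBody p ι J`
under the rung. [OURS] -/
theorem e2CentreH_of_glue (p : ℕ) (ι : (R : Type) → [CommRing R] → R → Ordinal.{0})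
    (J : (R : Type) → [CommRing R] → R → ℕ → Ideal R) (hc : PRungGrHomLE 3 p ι J → E2CentreGlueBody p ι J) :
    E2CentreH p ι J :=
  e2CentreH_of_forall_exists_admissible_canonical p ι J fun hr _ _ _ _ S h0 hreg =>
    hc hr S h0 hreg (e2MaxNonempty p ι J hr S h0 hreg) (e2MaxClosed p ι J hr S h0 hreg)

/-- **`stub_e2_centre_h` BY ITS STATEMENT from the single hypothesis (C-c)** (registrar quantifier shape; the three other pieces of
SPEC (Δ9) are tree theorems). [OURS] -/
theorem stub_e2_centre_h_of_glue
    (hc : ∀ p : ℕ, p.Prime → ∀ (ι : (R : Type) → [CommRing R] → R → Ordinal.{0})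
      (J : (R : Type) → [CommRing R] → R → ℕ → Ideal R), PRungGrHomLE 3 p ι J → E2CentreGlueBody p ι J) :
    ∀ p : ℕ, p.Prime → ∀ (ι : (R : Type) → [CommRing R] → R → Ordinal.{0})
      (J : (R : Type) → [CommRing R] → R → ℕ → Ideal R), E2CentreH p ι J :=
  fun p hp ι J => e2CentreH_of_glue p ι J (hc p hp ι J)

end Summit.ResolutionOfSingularities.ResolutionOfSingularities.Cruxes.HypersurfaceCentreConstruction.LocalEngine

end
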